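import Literature.NumberTheory.EllipticCurves.CasselsTateLocalTermLineFirstCase
import Literature.NumberTheory.EllipticCurves.HuShuYin2019.SylvesterPairNoFixedTwoPowerTorsion
import Literature.NumberTheory.EllipticCurves.JZeroTwoPowerTorsionMovingElement
import Literature.NumberTheory.EllipticCurves.SelmerTorsionCMOperatorJZero
import Literature.NumberTheory.EllipticCurves.ShaRestrictionJZeroDescent
import HarnessLib

/-!
# The COUPLED Cassels–Tate telescope, LIII: the (T-L2)′ LEAF of RESIDUE c v3 (l.122–169) for a Sylvester
# curve `E_n ⊗ K`, in ONE CALL from the FLIP (crux `UpperOffV0HSYPlus`, stmt-BirchSwinnertonDyer-19804)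

RESIDUE c v3 (display `RESIDUE-4.v3.display.txt` 8857513de2233188), conjunct (T-L2)′: for a Kolyvagin prime `ℓ`
of the level, a place `v₀ ∣ ℓ`, and the display's verbatim binders `j N' a b t ht hz …`, «NOT BOTH local
Cassels–Tate terms (over `t`, over `[ω] t`) vanish».  The tree's ★★
`FirstCaseData.false_of_forall_localTerm_eq_zero_of_line` (McCallum 1991 Lemma 5.3 in the `𝒪`-line form,
`…CasselsTateLocalTermLineFirstCase`) proves exactly this from: the `𝒪`-operator (`φ² + φ + 1 = 0`, here from the
pinned formula `φ(x, y) = (ω² x, ω³ y)` by `JZero.apply_apply_add_eq_zero_of_formula`), `E_n(K̄)[2^κ]^{Γ_K} = 0`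
(`HuShuYin2019.cubeSumCurve_geomTorsion_eq_zero_of_forall_smul_eq`, `n` odd), `[ω] t` Selmer
(`resH1Hom_id_mem_selmerGroup`), `2 ∉ v₀`, and the FLIP's transfer of the display's
`2^{a+(j−N')} • c_Y(m) ∉ ker loc_{v₀}` to `2^{a+(j−N')} • c_X(ℓm) ∉ Sel_{v₀}`.
* `two_notMem_asIdeal_of_odd_prime_mem` — `ℓ ∈ v₀`, `ℓ` an odd prime ⇒ `2 ∉ v₀`;
* ★ `tl2Leaf_cubeSumCurve_of_flip` — the leaf for `X = E_n ⊗ K` and any partner curve `Y/K`, binders = the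
  display's l.125–169 VERBATIM after `(ℓ, m)` and the FLIP at the places over `ℓ` (RESIDUE l.87–98's output).
Theorems only (no definition / named fact / instance); nothing asserted on 19804; no stub closed; X12.CMAtTwo NOT
proved; BSD not claimed for any curve.  Sources: [McCallumLMS1991] §5 Lemma 5.3, proof of Thm. 5.4;
[MilneADT2006] I §6 Prop. 6.9; [HuShuYin2019] §4.1.
-/

set_option linter.dupNamespace false -- Summits modules are `Summit.<Summit>.<Problem>…` by design
set_option autoImplicit false

noncomputable section

open scoped Classical

namespace Summit.BirchSwinnertonDyer.BirchSwinnertonDyer.Theorems.SylvesterTwoCoupledTelescope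

open Function NumberField IsDedekindDomain _root_.WeierstrassCurve Field
open Literature.NumberTheory.EllipticCurves Literature.NumberTheory.GaloisCohomology
  Literature.NumberTheory.GaloisRepresentations Literature.NumberTheory.EllipticCurves.HuShuYin2019

variable {K : Type} [Field K] [NumberField K]

/-- `ℓ ∈ v₀` for an odd prime `ℓ` ⇒ `2 ∉ v₀` (`1 = 2a + ℓb`). [folklore] -/
theorem two_notMem_asIdeal_of_odd_prime_mem (v₀ : HeightOneSpectrum (𝓞 K))
    {ℓ : ℕ} (hℓ : ℓ.Prime) (hℓ2 : ℓ ≠ 2) (hv₀ : (ℓ : 𝓞 K) ∈ v₀.asIdeal) : ((2 : ℕ) : 𝓞 K) ∉ v₀.asIdeal := by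
  intro h2
  have hcop : Nat.Coprime 2 ℓ := (Nat.coprime_primes Nat.prime_two hℓ).mpr (Ne.symm hℓ2)
  obtain ⟨a, b, hab⟩ := (Nat.isCoprime_iff_coprime.mpr hcop : IsCoprime (2 : ℤ) (ℓ : ℤ))
  apply v₀.isPrime.ne_top
  rw [Ideal.eq_top_iff_one]
  have h1 : ((a : 𝓞 K)) * ((2 : ℕ) : 𝓞 K) + (b : 𝓞 K) * (ℓ : 𝓞 K) = 1 := by
    exact_mod_cast congrArg (fun z : ℤ ↦ (z : 𝓞 K)) hab
  rw [← h1]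
  exact Ideal.add_mem _ (Ideal.mul_mem_left _ _ h2) (Ideal.mul_mem_left _ _ hv₀)

set_option maxHeartbeats 800000 in
/-- ★ **The (T-L2)′ leaf of RESIDUE c v3 for `X = E_n ⊗ K` (l.125–169 after `(ℓ, m)`), from the FLIP at the
places over `ℓ`**: given the display's `𝒪`-operator data `φ, fn, hfn, hφ, hcoe`, its Weil datum `e`, a Kolyvagin
prime `ℓ ≠ 2` with `X[4^κ] ⊆ X(K_q)` at the `q ∣ ℓ` (l.113–120), the classes `c = c_X(ℓm)`, `c' = c_Y(m)` with
the FLIP `2^a • c ∈ Sel_v ↔ 2^a • c' ∈ ker loc_v` (`v ∣ ℓ`), and the verbatim binders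
`j N' a b t ht hz htN hκj hN'κ habN hxB hbt v₀ hv₀ hD1 hD2`: `False`.
[cite: McCallumLMS1991, §5 Lemma 5.3 and proof of Thm. 5.4] [cite: MilneADT2006, Ch. I §6, proof of Prop. 6.9]
[cite: HuShuYin2019, §4.1] -/
theorem tl2Leaf_cubeSumCurve_of_flip {ω : K} (hω : ω ^ 2 + ω + 1 = 0) (h2 : Module.finrank ℚ K = 2)
    {n : ℚ} (hn : ∃ n₀ : ℤ, Odd n₀ ∧ (n₀ : ℚ) = n) [((cubeSumCurve n).baseChange K).IsElliptic]
    (Y : WeierstrassCurve K) {κ : ℕ} (hκ1 : 1 ≤ κ)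
    (φ : Isogeny ((cubeSumCurve n).baseChange K) ((cubeSumCurve n).baseChange K))
    (fn : geomTorsion ((cubeSumCurve n).baseChange K) ((2 ^ κ * 2 ^ κ : ℕ) : ℤ) →+
      geomTorsion ((cubeSumCurve n).baseChange K) ((2 ^ κ * 2 ^ κ : ℕ) : ℤ))
    (hfn : ∀ (g : absoluteGaloisGroup K) (Q : geomTorsion ((cubeSumCurve n).baseChange K) ((2 ^ κ * 2 ^ κ : ℕ) : ℤ)),
      fn (ContinuousMonoidHom.id _ g • Q) = g • fn Q)
    (hφ : ∀ (x y : AlgebraicClosure K)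
      (h : (((cubeSumCurve n).baseChange K).baseChange (AlgebraicClosure K)).toAffine.Nonsingular x y),
      ∃ h', φ (Affine.Point.some x y h) =
        Affine.Point.some (algebraMap K (AlgebraicClosure K) ω ^ 2 * x) (algebraMap K (AlgebraicClosure K) ω ^ 3 * y) h')
    (hcoe : ∀ Q : geomTorsion ((cubeSumCurve n).baseChange K) ((2 ^ κ * 2 ^ κ : ℕ) : ℤ),
      ((fn Q : geomTorsion ((cubeSumCurve n).baseChange K) ((2 ^ κ * 2 ^ κ : ℕ) : ℤ)) :
        geomPoints ((cubeSumCurve n).baseChange K)) = φ Q)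
    (e : geomTorsion ((cubeSumCurve n).baseChange K) ((2 ^ κ * 2 ^ κ : ℕ) : ℤ) →
      geomTorsion ((cubeSumCurve n).baseChange K) ((2 ^ κ * 2 ^ κ : ℕ) : ℤ) → AlgebraicClosure K)
    (hμ : ∀ S T, e S T ^ (2 ^ κ * 2 ^ κ) = 1)
    (hadd₁ : ∀ S₁ S₂ T, e (S₁ + S₂) T = e S₁ T * e S₂ T)
    (hadd₂ : ∀ S T₁ T₂, e S (T₁ + T₂) = e S T₁ * e S T₂)
    (hgal : ∀ (σ : absoluteGaloisGroup K) (S T : geomTorsion ((cubeSumCurve n).baseChange K) ((2 ^ κ * 2 ^ κ : ℕ) : ℤ)),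
      σ • e S T = e (σ • S) (σ • T))
    (halt : ∀ T, e T T = 1) (hnondeg : ∀ T, (∀ S, e S T = 1) → T = 0)
    {ℓ : ℕ} (hℓ : ℓ.Prime) (hℓ2 : ℓ ≠ 2)
    (hlev : ∀ q : HeightOneSpectrum (𝓞 K), (ℓ : 𝓞 K) ∈ q.asIdeal →
      ∀ (g : absoluteGaloisGroup (Place.Completion (Sum.inr q : Place K)))
        (Q : geomTorsion ((cubeSumCurve n).baseChange K) ((2 ^ κ * 2 ^ κ : ℕ) : ℤ)),
        absGaloisRestrict K (Place.Completion (Sum.inr q : Place K)) g • Q = Q)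
    (c : galH1Torsion ((cubeSumCurve n).baseChange K) ((2 ^ κ * 2 ^ κ : ℕ) : ℤ))
    (c' : galH1Torsion Y ((2 ^ κ * 2 ^ κ : ℕ) : ℤ))
    (hflip : ∀ v : HeightOneSpectrum (𝓞 K), (ℓ : 𝓞 K) ∈ v.asIdeal → ∀ a : ℕ,
      (((2 : ℤ) ^ a) • c ∈ selmerLocalKer ((cubeSumCurve n).baseChange K) (v.adicCompletion K) ((2 ^ κ * 2 ^ κ : ℕ) : ℤ) ↔
        ((2 : ℤ) ^ a) • c' ∈ Y.torsionLocalKer (v.adicCompletion K) ((2 ^ κ * 2 ^ κ : ℕ) : ℤ)))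
    -- RESIDUE c v3 l.125–169 VERBATIM from here (`X := E_n ⊗ K`, `c_X(ℓm) := c`, `c_Y(m) := c'`)
    (j N' a b : ℕ) (t : galH1Torsion ((cubeSumCurve n).baseChange K) ((2 ^ κ * 2 ^ κ : ℕ) : ℤ))
    (ht : t ∈ selmerGroup ((cubeSumCurve n).baseChange K) ((2 ^ κ * 2 ^ κ : ℕ) : ℤ))
    (hz : ((2 : ℤ) ^ j) • c ∈ selmerGroup ((cubeSumCurve n).baseChange K) ((2 ^ κ * 2 ^ κ : ℕ) : ℤ))
    (htN : ((2 : ℤ) ^ N') • t = 0) (hκj : κ ≤ j) (hN'κ : N' ≤ κ) (habN : a + b + 1 = N')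
    (hxB : ∀ v : HeightOneSpectrum (𝓞 K), (ℓ : 𝓞 K) ∈ v.asIdeal →
      ((2 : ℤ) ^ (a + (j - N'))) • c' ∉ Y.torsionLocalKer (v.adicCompletion K) ((2 ^ κ * 2 ^ κ : ℕ) : ℤ))
    (hbt : ∀ v : HeightOneSpectrum (𝓞 K), (ℓ : 𝓞 K) ∈ v.asIdeal → ((2 : ℤ) ^ b) • t ∉
      ((cubeSumCurve n).baseChange K).torsionLocalKer (v.adicCompletion K) ((2 ^ κ * 2 ^ κ : ℕ) : ℤ))
    (v₀ : HeightOneSpectrum (𝓞 K)) (hv₀ : (ℓ : 𝓞 K) ∈ v₀.asIdeal)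
    (hD1 : ∀ D : FirstCaseData ((cubeSumCurve n).baseChange K) (2 ^ κ), D.b₁ = ((2 : ℤ) ^ (j - κ)) • c →
      galoisCohomology.map (inclKD ((cubeSumCurve n).baseChange K) (2 ^ κ) (2 ^ κ)) 1 D.b' = t →
      D.localTerm e hμ hadd₁ hadd₂ hgal (LocalInvariants.canonical K (2 ^ κ * 2 ^ κ)) (Sum.inr v₀) = 0)
    (hD2 : ∀ D : FirstCaseData ((cubeSumCurve n).baseChange K) (2 ^ κ), D.b₁ = ((2 : ℤ) ^ (j - κ)) • c →
      galoisCohomology.map (inclKD ((cubeSumCurve n).baseChange K) (2 ^ κ) (2 ^ κ)) 1 D.b' =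
        resH1Hom (ContinuousMonoidHom.id _) fn hfn t →
      D.localTerm e hμ hadd₁ hadd₂ hgal (LocalInvariants.canonical K (2 ^ κ * 2 ^ κ)) (Sum.inr v₀) = 0) :
    False := by
  -- ### the `𝒪`-operator: `φ² + φ + 1 = 0` from the pinned formula; its local points maps; `[ω] t` Selmer
  have hζ : IsPrimitiveRoot ω 3 := (JZero.exists_aut_apply_eq_sq K hω h2).1
  have hV : (cubeSumCurve n).baseChange K = ⟨0, 0, 0, 0, algebraMap ℚ K (-432 * n ^ 2)⟩ := by
    ext <;> simp [WeierstrassCurve.baseChange, cubeSumCurve]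
  have hf : ∀ P, φ (φ P) + φ P + P = 0 := JZero.apply_apply_add_eq_zero_of_formula hV hζ φ hφ
  obtain ⟨fE, hfE, hcomp⟩ := φ.hasLocalPointsMaps_toAddMonoidHom (Place.Completion (Sum.inr v₀ : Place K))
  have hwtsel : resH1Hom (ContinuousMonoidHom.id _) fn hfn t ∈
      selmerGroup ((cubeSumCurve n).baseChange K) ((2 ^ κ * 2 ^ κ : ℕ) : ℤ) :=
    resH1Hom_id_mem_selmerGroup _ fn hfn φ.toAddMonoidHom hcoe φ.hasLocalPointsMaps_toAddMonoidHom ht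
  -- ### `E_n(K̄)[2^κ]^{Γ_K} = 0` (`n` odd), `2 ∉ v₀`
  have hnofixK : ∀ P : geomTorsion ((cubeSumCurve n).baseChange K) ((2 ^ κ : ℕ) : ℤ),
      (∀ σ : absoluteGaloisGroup K, σ • P = P) → P = 0 :=
    fun P hP ↦ cubeSumCurve_geomTorsion_eq_zero_of_forall_smul_eq hω h2 hn (m := 2 ^ κ) (k := κ) rfl P hP
  have h2v₀ := two_notMem_asIdeal_of_odd_prime_mem v₀ hℓ hℓ2 hv₀
  -- ### FLIP bookkeeping: `2^{a+(j−N')} • c ∉ Sel_{v₀}`, rescaled to `2^{a+κ−N'} • res (2^{j−κ} • c) ∉ 𝓛_{v₀}`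
  have hxA : ((2 : ℤ) ^ (a + (j - N'))) • c ∉
      selmerLocalKer ((cubeSumCurve n).baseChange K) (v₀.adicCompletion K) ((2 ^ κ * 2 ^ κ : ℕ) : ℤ) :=
    fun h ↦ hxB v₀ hv₀ ((hflip v₀ hv₀ _).mp h)
  have hpow : ((2 : ℤ) ^ (a + (j - N'))) = (2 : ℤ) ^ (a + κ - N') * (2 : ℤ) ^ (j - κ) := by
    rw [← pow_add]; congr 1; omega
  have hx : ((2 : ℤ) ^ (a + κ - N')) •
      galoisCohomology.res (((cubeSumCurve n).baseChange K).torsionGaloisModule ((2 ^ κ * 2 ^ κ : ℕ) : ℤ))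
        (Place.Completion (Sum.inr v₀ : Place K)) 1 (((2 : ℤ) ^ (j - κ)) • c) ∉
      ((cubeSumCurve n).baseChange K).kummerLocalConditionAt ((2 ^ κ * 2 ^ κ : ℕ) : ℤ)
        (Place.Completion (Sum.inr v₀ : Place K)) := by
    intro h
    refine hxA (mem_selmerLocalKer_of_mem_kummerLocalConditionAt_res _ _ (v₀.adicCompletion K) ?_)
    rw [hpow, mul_zsmul]
    erw [map_zsmul]
    exact h
  -- ### `(2^κ : ℤ) • 2^{j−κ} • c = 2^j • c` is Selmer
  have hb₁ : (((2 ^ κ : ℕ) : ℤ)) • (((2 : ℤ) ^ (j - κ)) • c) ∈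
      selmerGroup ((cubeSumCurve n).baseChange K) ((2 ^ κ * 2 ^ κ : ℕ) : ℤ) := by
    rw [← mul_zsmul, Nat.cast_pow, Nat.cast_ofNat, ← pow_add (2 : ℤ) κ (j - κ), Nat.add_sub_cancel' hκj]
    exact hz
  exact FirstCaseData.false_of_forall_localTerm_eq_zero_of_line (m := 2 ^ κ) hκ1 rfl v₀ h2v₀ e hμ hadd₁
    hadd₂ hgal halt hnondeg φ.toAddMonoidHom φ.equivariant hf fE hfE hcomp fn hfn hcoe (hlev v₀ hv₀) hnofixK hb₁ ht
    hwtsel hN'κ htN hx (hbt v₀ hv₀) (by omega) hD1 hD2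

end Summit.BirchSwinnertonDyer.BirchSwinnertonDyer.Theorems.SylvesterTwoCoupledTelescope

end
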